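import Summits.QuantumFields.BalabanUV.T4Continuum.Support.KingPairingPlantedLaw

/-!
# T⁴ programme, spine node NE2 (U1a), tier B support row B4.d — THE UNIT-BLOCK PROJECTION TOWER `K_k` and its
# BLOCK POINCARÉ INEQUALITY (file 2 of row B4.d: the mass term of the U = 1 scalar layer, on the vector index)

NE2 formalisation swarm `b2b-balaban-t4-ne2-formalise-*`, seat LEAF PROVER 04, support row B4.d of `t4/formal/NE2/LEAVES.md` (U = 1
SCALAR FREE-TOWER LAWS against King's pairing — the datum «free scalar-tower planting/complement defects» of row B4.b).  The scalar
layer's free operator at level `k` is `Δ_k + a′Q′_k*Q′_k` ([Balaban1985BackgroundPropagators] (3.24) p.394 «Δ′_a = Δ^η_U + Q′*aQ′» at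
`U = 1`); with B5's weighted adjoint `Q′* = n^d·Q′ᴴ` the mass term `n^dQ′_kᴴQ′_k` is the ORTHOGONAL PROJECTION onto the fields that are
constant on the unit blocks (`n = L^k` sites a side).  This file types that projection ALONG THE TOWER of the route, on the vector index
`idx L M k = T^{(k)} × Fin d` (componentwise; the 0-form statement is the restriction to one component), by King's one-step averagings:

 * §1 **`Kproj k := (L^d)^k • (Atow (Qlev L M) k)ᴴ (Atow (Qlev L M) k)`** and the EXACT RECURSION `Kproj (k+1) = J_k (Kproj k) J_kᴴ`
   (`J_k = JpcT L M k = √(L^d)·Q_kᴴ` King's isometric planting): `Kproj` is a Hermitian idempotent of norm `≤ 1`, and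
   **`Kproj_succ_mul_JpcT : Kproj (k+1) J_k = J_k Kproj k`** — the mass terms of adjacent levels INTERTWINE EXACTLY (the input of
   the sandwich identity `Support/OneStepEffectiveOperator.sandwich_inv_eq`, whose `B′ = J B Jᴴ` is literally `Kproj_succ`);
 * §2 block averaging versus translations: `cpt (y + e_ν) = cpt y + R·e_ν` and **`Qavg_mul_transl_tstep`**
   (`Q_R · T′_{R e_ν} = S_ν · Q_R`: averaging a field translated by one block = translating the averages by one site), hence
   `(S_ν − 1)J_Rᴴ = J_Rᴴ(T′_{Re_ν} − 1)`;
 * §3 **THE BLOCK POINCARÉ INEQUALITY FOR `Kproj`** (`L ≥ 2`, Hermitian `X`): `‖(1 − Kproj k) X‖ ≤ 8d(L^k − 1)·δ` whenever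
   `‖(S_ν − 1)X‖ ≤ δ` for every axis — by induction over the tower from the ONE-STEP inequality `BalabanBlockPoincare.opNorm_one_sub_Pi_mul_le`
   (`1 − K′ = (1 − Π) + J(1 − K)Jᴴ`, `Π = JJᴴ`; the geometric sum `Σ L^j` against `δ ∝ L^{−k}` is what makes the coercivity constant
   of the next file level-independent).

HONEST FRAMING (T4-DAG p. 1).  `U = 1`, finite torus, exact lattice bookkeeping + one inequality; statements and constants OURS
([folklore]); a SUPPORT input of row B4.b (via B4.d), NOT B4, NOT [Balaban1985BackgroundPropagators] (3.23)–(3.26) as printed; NE2 NOT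
proved; NOT infinite volume / mass gap / Clay / summit progress; spine 0/9 unchanged.  HONEST DEPENDENCY: continuum YM on T⁴ ⇐
BetaPertH ∧ nine spine estimates (0/9 proved); BetaPertH ⇐ (D1) ∧ (D4) ∧ CAP+tail; G-an2-4 gates asym, D1 and NE2/3/4.  ABSOLUTE RULE
kept; no `sorry`.
-/

noncomputable section

open scoped BigOperators ComplexConjugate Matrix Matrix.Norms.L2Operator

namespace Summit.QuantumFields.BalabanUV.T4Continuum.ScalarMassTower

open Literature.MathematicalPhysics.QuantumFieldTheory.Balaban1983to89.B5Prop11Plancherel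
open Literature.MathematicalPhysics.QuantumFieldTheory.Balaban1983to89.B5Block118 (tstep tstep_zero tstep_succ)
open Literature.MathematicalPhysics.QuantumFieldTheory.Balaban1983to89.B5G183RateTorus (cpt)
open Literature.MathematicalPhysics.QuantumFieldTheory.Balaban1983to89.B5G183RateTorusW (off Qavg Qavg_mul_apply opNorm_Qavg_le)
open Literature.MathematicalPhysics.QuantumFieldTheory.Balaban1983to89.B5G183RateUnitTower (lev lev_neZero)
open Summit.QuantumFields.BalabanUV.T4Continuum
open Summit.QuantumFields.BalabanUV.T4Continuum.CovariantAveragingTower (Atow Atow_zero Atow_succ)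
open Summit.QuantumFields.BalabanUV.T4Continuum.BalabanAveragedTowerUnit (idx Qlev lev_succ' one_le_lev' cast_lev')
open Summit.QuantumFields.BalabanUV.T4Continuum.BalabanBlockPoincare (transl transl_mul_apply transl_zero transl_add shiftM_eq_transl
  opNorm_transl_le opNorm_transl_tstep_sub_one_mul_le Pi opNorm_one_sub_Pi_mul_le)
open Summit.QuantumFields.BalabanUV.T4Continuum.KingPairingPlantedLaw

variable {d : ℕ}

/-! ## §1 The unit-block projection tower -/

section Tower

variable (L : ℕ) [NeZero L] (M : Fin d → ℕ) [hM : ∀ μ, NeZero (M μ)]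

/-- **THE UNIT-BLOCK PROJECTION at level `k`**: `(L^d)^k · (Atow Q k)ᴴ (Atow Q k)` — the orthogonal projection onto the vector fields
on `T^{(k)}` that are constant on the blocks of `L^k` sites a side (the unit blocks); at `U = 1` it is the mass operator `n^dQ′_kᴴQ′_k` of
the scalar layer, componentwise. [cite: Balaban1985BackgroundPropagators, (3.24) p.394 (shape: the `Q′*aQ′` term)] [folklore] -/
def Kproj (k : ℕ) : Matrix (idx L M k) (idx L M k) ℂ :=
  (((L : ℂ) ^ d) ^ k) • ((Atow (Qlev L M) k)ᴴ * Atow (Qlev L M) k)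

/-- `K_0 = 1` (on the unit lattice every field is block-constant). [folklore] -/
theorem Kproj_zero : Kproj L M 0 = 1 := by
  simp [Kproj, Atow_zero]

omit [NeZero L] hM in
/-- King's planting is `√(L^d)·Q_kᴴ` (definitional). [folklore] -/
theorem JpcT_eq_smul (k : ℕ) : JpcT L M k = (((Real.sqrt ((L : ℝ) ^ d)) : ℝ) : ℂ) • (Qlev L M k)ᴴ := rfl

/-- **THE RECURSION `K_{k+1} = J_k K_k J_kᴴ`**. [folklore] -/
theorem Kproj_succ (k : ℕ) : Kproj L M (k + 1) = JpcT L M k * Kproj L M k * (JpcT L M k)ᴴ := by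
  obtain ⟨hs, hss⟩ := sqrt_facts (d := d) L
  have e1 : JpcT L M k * Kproj L M k * (JpcT L M k)ᴴ
      = ((((Real.sqrt ((L : ℝ) ^ d)) : ℝ) : ℂ) * (((Real.sqrt ((L : ℝ) ^ d)) : ℝ) : ℂ) * (((L : ℂ) ^ d) ^ k))
        • ((Qlev L M k)ᴴ * ((Atow (Qlev L M) k)ᴴ * (Atow (Qlev L M) k * Qlev L M k))) := by
    rw [JpcT_eq_smul, Matrix.conjTranspose_smul, Matrix.conjTranspose_conjTranspose, hs, Kproj]
    simp only [Matrix.smul_mul, Matrix.mul_smul, smul_smul, Matrix.mul_assoc]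
    congr 1
    ring
  rw [e1, hss, ← pow_succ', Kproj, Atow_succ, Matrix.conjTranspose_mul]
  simp only [Matrix.mul_assoc]

/-- `K_k` is Hermitian. [folklore] -/
theorem Kproj_isHermitian (k : ℕ) : (Kproj L M k).IsHermitian := by
  unfold Kproj Matrix.IsHermitian
  rw [Matrix.conjTranspose_smul, Matrix.conjTranspose_mul, Matrix.conjTranspose_conjTranspose]
  congr 1
  rw [Complex.star_def, map_pow, map_pow, Complex.conj_natCast]

/-- `K_k` is idempotent. [folklore] -/
theorem Kproj_mul_self (k : ℕ) : Kproj L M k * Kproj L M k = Kproj L M k := by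
  induction k with
  | zero => rw [Kproj_zero, Matrix.mul_one]
  | succ k ih =>
    rw [Kproj_succ]
    calc JpcT L M k * Kproj L M k * (JpcT L M k)ᴴ * (JpcT L M k * Kproj L M k * (JpcT L M k)ᴴ)
        = JpcT L M k * Kproj L M k * ((JpcT L M k)ᴴ * JpcT L M k) * Kproj L M k * (JpcT L M k)ᴴ := by
          simp only [Matrix.mul_assoc]
      _ = JpcT L M k * Kproj L M k * (JpcT L M k)ᴴ := by
          rw [JpcT_conjTranspose_mul_JpcT, Matrix.mul_one, Matrix.mul_assoc (JpcT L M k) (Kproj L M k) (Kproj L M k), ih]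

/-- an orthogonal projection has norm `≤ 1`. [folklore] -/
theorem opNorm_le_one_of_proj {m : Type*} [Fintype m] [DecidableEq m] {P : Matrix m m ℂ} (h1 : Pᴴ = P) (h2 : P * P = P) :
    ‖P‖ ≤ 1 := by
  have hsq : ‖P‖ * ‖P‖ = ‖P‖ := by
    have h := Matrix.l2_opNorm_conjTranspose_mul_self P
    rw [h1, h2] at h
    exact h.symm
  by_contra hgt
  rw [not_le] at hgt
  have hpos : 0 < ‖P‖ := lt_trans zero_lt_one hgt
  have : ‖P‖ = 1 := by
    have h3 : ‖P‖ * ‖P‖ = ‖P‖ * 1 := by rw [hsq, mul_one]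
    exact mul_left_cancel₀ hpos.ne' h3
  exact absurd this (ne_of_gt hgt)

/-- `‖K_k‖ ≤ 1`. [folklore] -/
theorem opNorm_Kproj_le (k : ℕ) : ‖Kproj L M k‖ ≤ 1 :=
  opNorm_le_one_of_proj (Kproj_isHermitian L M k).eq (Kproj_mul_self L M k)

/-- `1 − K_k` is Hermitian and idempotent. [folklore] -/
theorem one_sub_Kproj_proj (k : ℕ) :
    (1 - Kproj L M k)ᴴ = 1 - Kproj L M k ∧ (1 - Kproj L M k) * (1 - Kproj L M k) = 1 - Kproj L M k := by
  refine ⟨?_, ?_⟩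
  · rw [Matrix.conjTranspose_sub, Matrix.conjTranspose_one, (Kproj_isHermitian L M k).eq]
  · rw [Matrix.sub_mul, Matrix.mul_sub, Matrix.mul_sub, Matrix.one_mul, Matrix.mul_one, Matrix.one_mul, Kproj_mul_self]
    abel

/-- `‖1 − K_k‖ ≤ 1`. [folklore] -/
theorem opNorm_one_sub_Kproj_le (k : ℕ) : ‖1 - Kproj L M k‖ ≤ 1 :=
  opNorm_le_one_of_proj (one_sub_Kproj_proj L M k).1 (one_sub_Kproj_proj L M k).2

/-- **THE MASS TERMS INTERTWINE EXACTLY**: `K_{k+1} J_k = J_k K_k`. [folklore] -/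
theorem Kproj_succ_mul_JpcT (k : ℕ) : Kproj L M (k + 1) * JpcT L M k = JpcT L M k * Kproj L M k := by
  rw [Kproj_succ, Matrix.mul_assoc, JpcT_conjTranspose_mul_JpcT, Matrix.mul_one]

/-- `Π_k − K_{k+1} = J_k (1 − K_k) J_kᴴ` (`Π_k = J_kJ_kᴴ` the one-step block-mean projector at level `k + 1`). [folklore] -/
theorem Pi_sub_Kproj_succ (k : ℕ) :
    JpcT L M k * (JpcT L M k)ᴴ - Kproj L M (k + 1) = JpcT L M k * (1 - Kproj L M k) * (JpcT L M k)ᴴ := by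
  rw [Matrix.mul_sub, Matrix.sub_mul, Matrix.mul_one, Kproj_succ]

end Tower

/-! ## §2 Block averaging versus translations -/

section Transl

variable (N R : ℕ) [NeZero N] [NeZero R] (M : Fin d → ℕ) [hM : ∀ μ, NeZero (M μ)]

omit [NeZero R] in
/-- **`cpt (y + e_ν) = cpt y + R·e_ν`**: the corner of the next block is `R` fine steps away (torus wrap-around included).
[folklore] -/
theorem cpt_add_unitVec (ν : Fin d) (y : Tor (fine N M)) :
    cpt N R M (y + unitVec (fine N M) ν) = cpt N R M y + tstep (fine (R * N) M) ν R := by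
  funext μ
  simp only [cpt, tstep, Pi.add_apply, unitVec]
  by_cases hμ : μ = ν
  · subst hμ
    simp only [Pi.single_eq_same, if_true]
    set v := (y μ).val with hv
    set m := fine N M μ with hm
    have hval : (y μ + 1).val = (v + 1) % m := by
      rw [ZMod.val_add, ← hv, ZMod.val_one_eq_one_mod, hm, Nat.add_mod_mod]
    rw [hval]
    have hdecomp : R * (v + 1) = R * ((v + 1) % m) + fine (R * N) M μ * ((v + 1) / m) := by
      have h1 := Nat.mod_add_div (v + 1) m
      have h2 : fine (R * N) M μ = R * m := by simp only [hm, fine]; ring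
      rw [h2]
      calc R * (v + 1) = R * ((v + 1) % m + m * ((v + 1) / m)) := by rw [h1]
        _ = R * ((v + 1) % m) + R * m * ((v + 1) / m) := by ring
    have hcast : ((R * (v + 1) : ℕ) : ZMod (fine (R * N) M μ)) = ((R * ((v + 1) % m) : ℕ) : ZMod (fine (R * N) M μ)) := by
      rw [hdecomp, Nat.cast_add, Nat.cast_mul (fine (R * N) M μ), ZMod.natCast_self, zero_mul, add_zero]
    rw [← hcast, Nat.mul_add, mul_one, Nat.cast_add, Nat.cast_mul]
  · simp only [Pi.single_eq_of_ne hμ, if_neg hμ, add_zero]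

/-- **`Q_R T′_{Re_ν} = S_ν Q_R`** on any matrix: averaging a field translated by one block = translating the averages by one
site. [cite: King1986, (2.10) p.653] [folklore] -/
theorem Qavg_mul_transl_tstep_mul {β : Type*} (ν : Fin d) (X : Matrix (Tor (fine (R * N) M) × Fin d) β ℂ) :
    Qavg N R M * (transl (fine (R * N) M) (tstep (fine (R * N) M) ν R) * X) = shiftM (fine N M) ν * (Qavg N R M * X) := by
  ext i b
  rw [Qavg_mul_apply, shiftM_eq_transl, transl_mul_apply, Qavg_mul_apply]
  congr 1
  refine Finset.sum_congr rfl fun j _ => ?_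
  rw [transl_mul_apply, cpt_add_unitVec, add_right_comm (cpt N R M i.1)]

/-- the same as an identity of operators. [folklore] -/
theorem Qavg_mul_transl_tstep (ν : Fin d) :
    Qavg N R M * transl (fine (R * N) M) (tstep (fine (R * N) M) ν R) = shiftM (fine N M) ν * Qavg N R M := by
  have h := Qavg_mul_transl_tstep_mul N R M ν (1 : Matrix (Tor (fine (R * N) M) × Fin d) (Tor (fine (R * N) M) × Fin d) ℂ)
  rwa [Matrix.mul_one, Matrix.mul_one] at h

/-- **`(S_ν − 1) J_Rᴴ = J_Rᴴ (T′_{Re_ν} − 1)`**. [folklore] -/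
theorem shiftM_sub_one_mul_JKH (ν : Fin d) :
    (shiftM (fine N M) ν - 1) * (JK N R M)ᴴ = (JK N R M)ᴴ * (transl (fine (R * N) M) (tstep (fine (R * N) M) ν R) - 1) := by
  obtain ⟨hs, -⟩ := sqrt_facts (d := d) R
  rw [JK, Matrix.conjTranspose_smul, Matrix.conjTranspose_conjTranspose, hs, Matrix.mul_smul, Matrix.smul_mul, Matrix.sub_mul,
    Matrix.mul_sub, Matrix.one_mul, Matrix.mul_one, Qavg_mul_transl_tstep]

/-- hence **`‖(S_ν − 1)·(J_Rᴴ X J_R)‖ ≤ R·δ`** whenever `‖(S′_μ − 1)X‖ ≤ δ` for every fine axis `μ`. [folklore] -/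
theorem opNorm_shiftM_sub_one_mul_sandwich_le (X : Matrix (Tor (fine (R * N) M) × Fin d) (Tor (fine (R * N) M) × Fin d) ℂ)
    {δ : ℝ} (hδ : 0 ≤ δ) (hX : ∀ μ, ‖(shiftM (fine (R * N) M) μ - 1) * X‖ ≤ δ) (ν : Fin d) :
    ‖(shiftM (fine N M) ν - 1) * ((JK N R M)ᴴ * X * JK N R M)‖ ≤ R * δ := by
  have e : (shiftM (fine N M) ν - 1) * ((JK N R M)ᴴ * X * JK N R M)
      = (JK N R M)ᴴ * ((transl (fine (R * N) M) (tstep (fine (R * N) M) ν R) - 1) * X) * JK N R M := by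
    rw [← Matrix.mul_assoc, ← Matrix.mul_assoc, shiftM_sub_one_mul_JKH, Matrix.mul_assoc ((JK N R M)ᴴ)]
  rw [e]
  have h1 : ‖(JK N R M)ᴴ‖ ≤ 1 := by rw [Matrix.l2_opNorm_conjTranspose]; exact opNorm_JK_le N R M
  calc ‖(JK N R M)ᴴ * ((transl (fine (R * N) M) (tstep (fine (R * N) M) ν R) - 1) * X) * JK N R M‖
      ≤ ‖(JK N R M)ᴴ‖ * ‖(transl (fine (R * N) M) (tstep (fine (R * N) M) ν R) - 1) * X‖ * ‖JK N R M‖ :=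
        (Matrix.l2_opNorm_mul _ _).trans (mul_le_mul_of_nonneg_right (Matrix.l2_opNorm_mul _ _) (norm_nonneg _))
    _ ≤ 1 * (R * δ) * 1 := by
        refine mul_le_mul (mul_le_mul h1 (opNorm_transl_tstep_sub_one_mul_le _ X ν (hX ν) R) (norm_nonneg _) zero_le_one)
          (opNorm_JK_le N R M) (norm_nonneg _) (by positivity)
    _ = R * δ := by ring

end Transl

/-! ## §3 The block Poincaré inequality for `Kproj` -/

section Poincare

variable (L : ℕ) [NeZero L] (M : Fin d → ℕ) [hM : ∀ μ, NeZero (M μ)]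

/-- the one-step block Poincaré inequality at tower level: `‖(1 − J_kJ_kᴴ)X‖ ≤ 2dL·δ` whenever `‖(S_ν − 1)X‖ ≤ δ` for every axis.
[folklore] -/
theorem opNorm_one_sub_JJH_mul_le (k : ℕ) (X : Matrix (idx L M (k + 1)) (idx L M (k + 1)) ℂ) {δ : ℝ} (hδ : 0 ≤ δ)
    (hX : ∀ ν, ‖(shiftM (fine (lev L (k + 1)) M) ν - 1) * X‖ ≤ δ) :
    ‖(1 - JpcT L M k * (JpcT L M k)ᴴ) * X‖ ≤ 2 * (d * L * δ) := by
  have h := opNorm_one_sub_Pi_mul_le (lev L k) L M X hδ hX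
  rw [← JK_mul_conjTranspose] at h
  exact h

/-- `‖Aᴴ‖ = ‖A‖`-transport of the axis defects of a Hermitian matrix to the sandwich `J_kᴴ X J_k`: if `X` is Hermitian then so is
`J_kᴴXJ_k`. [folklore] -/
theorem sandwich_isHermitian (k : ℕ) {X : Matrix (idx L M (k + 1)) (idx L M (k + 1)) ℂ} (hX : X.IsHermitian) :
    ((JpcT L M k)ᴴ * X * JpcT L M k).IsHermitian := by
  have h := Matrix.isHermitian_conjTranspose_mul_mul (JpcT L M k) hX
  exact h

/-- **THE BLOCK POINCARÉ INEQUALITY FOR THE UNIT-BLOCK PROJECTION** (`L ≥ 2`): for a HERMITIAN `X` on level `k` with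
`‖(S_ν − 1)X‖ ≤ δ` for every axis, `‖(1 − K_k)X‖ ≤ 8d(L^k − 1)·δ`.  With `S_ν − 1 = ∇_ν/L^k`: a Hermitian operator with bounded
lattice gradients is within `8d·‖∇X‖` of its unit-block means, UNIFORMLY in `k`. [folklore] -/
theorem opNorm_one_sub_Kproj_mul_le (hL : 2 ≤ L) :
    ∀ (k : ℕ) (X : Matrix (idx L M k) (idx L M k) ℂ), X.IsHermitian → ∀ {δ : ℝ}, 0 ≤ δ →
      (∀ ν, ‖(shiftM (fine (lev L k) M) ν - 1) * X‖ ≤ δ) → ‖(1 - Kproj L M k) * X‖ ≤ 8 * d * ((L : ℝ) ^ k - 1) * δ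
  | 0, X, _, δ, _, _ => by
    rw [Kproj_zero, sub_self, Matrix.zero_mul, norm_zero, pow_zero, sub_self, mul_zero, zero_mul]
  | k + 1, X, hX, δ, hδ, hS => by
    have hLr : (2 : ℝ) ≤ L := by exact_mod_cast hL
    have hd : (0 : ℝ) ≤ d := Nat.cast_nonneg d
    have hLk : (1 : ℝ) ≤ (L : ℝ) ^ k := one_le_pow₀ (by linarith)
    -- the pieces
    set J := JpcT L M k with hJ
    set K := Kproj L M k with hK
    set Y : Matrix (idx L M k) (idx L M k) ℂ := Jᴴ * X * J with hY
    have hJ1 : ‖J‖ ≤ 1 := opNorm_JpcT_le L M k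
    have hJH1 : ‖Jᴴ‖ ≤ 1 := by rw [Matrix.l2_opNorm_conjTranspose]; exact hJ1
    -- (i) one step
    have h1 : ‖(1 - J * Jᴴ) * X‖ ≤ 2 * (d * L * δ) := opNorm_one_sub_JJH_mul_le L M k X hδ hS
    -- (ii) the induction hypothesis on the sandwich `Y = JᴴXJ` (Hermitian, axis defects `≤ L·δ`)
    have hYh : Y.IsHermitian := sandwich_isHermitian L M k hX
    have hYS : ∀ ν, ‖(shiftM (fine (lev L k) M) ν - 1) * Y‖ ≤ L * δ := fun ν =>
      opNorm_shiftM_sub_one_mul_sandwich_le (lev L k) L M X hδ hS ν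
    have h2 : ‖(1 - K) * Y‖ ≤ 8 * d * ((L : ℝ) ^ k - 1) * (L * δ) :=
      opNorm_one_sub_Kproj_mul_le hL k Y hYh (by positivity) hYS
    -- (iii) the cross term `J(1 − K)JᴴX(1 − JJᴴ)`: `‖X(1 − JJᴴ)‖ = ‖(1 − JJᴴ)X‖` for Hermitian `X`
    have hPh : (1 - J * Jᴴ : Matrix (idx L M (k + 1)) (idx L M (k + 1)) ℂ)ᴴ = 1 - J * Jᴴ := by
      rw [Matrix.conjTranspose_sub, Matrix.conjTranspose_one, Matrix.conjTranspose_mul, Matrix.conjTranspose_conjTranspose]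
    have h3 : ‖X * (1 - J * Jᴴ)‖ ≤ 2 * (d * L * δ) := by
      have e : X * (1 - J * Jᴴ) = ((1 - J * Jᴴ) * X)ᴴ := by
        rw [Matrix.conjTranspose_mul, hPh, hX.eq]
      rw [e, Matrix.l2_opNorm_conjTranspose]; exact h1
    -- the decomposition `(1 − K′)X = (1 − JJᴴ)X + J[(1 − K)Y]Jᴴ + J(1 − K)Jᴴ[X(1 − JJᴴ)]`
    have hJJ : Jᴴ * J = 1 := JpcT_conjTranspose_mul_JpcT L M k
    have e : (1 - Kproj L M (k + 1)) * X
        = (1 - J * Jᴴ) * X + J * ((1 - K) * Y) * Jᴴ + J * (1 - K) * Jᴴ * (X * (1 - J * Jᴴ)) := by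
      have e1 : (1 - Kproj L M (k + 1)) = (1 - J * Jᴴ) + J * (1 - K) * Jᴴ := by
        rw [← Pi_sub_Kproj_succ]; abel
      rw [e1, Matrix.add_mul, add_assoc]
      congr 1
      -- `J(1−K)JᴴX = J(1−K)JᴴX(JJᴴ) + J(1−K)JᴴX(1 − JJᴴ)`
      have eA : J * ((1 - K) * Y) * Jᴴ = J * (1 - K) * Jᴴ * X * (J * Jᴴ) := by
        rw [hY]; simp only [Matrix.mul_assoc]
      have eB : J * (1 - K) * Jᴴ * (X * (1 - J * Jᴴ)) = J * (1 - K) * Jᴴ * X - J * (1 - K) * Jᴴ * X * (J * Jᴴ) := by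
        rw [Matrix.mul_sub X (1 : Matrix (idx L M (k + 1)) (idx L M (k + 1)) ℂ) (J * Jᴴ), Matrix.mul_one,
          Matrix.mul_sub (J * (1 - K) * Jᴴ) X (X * (J * Jᴴ)), ← Matrix.mul_assoc (J * (1 - K) * Jᴴ) X (J * Jᴴ)]
      rw [eA, eB]
      abel
    rw [e]
    have hK1 : ‖1 - K‖ ≤ 1 := opNorm_one_sub_Kproj_le L M k
    have t2 : ‖J * ((1 - K) * Y) * Jᴴ‖ ≤ 8 * d * ((L : ℝ) ^ k - 1) * (L * δ) := by
      calc ‖J * ((1 - K) * Y) * Jᴴ‖ ≤ ‖J‖ * ‖(1 - K) * Y‖ * ‖Jᴴ‖ :=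
            (Matrix.l2_opNorm_mul _ _).trans (mul_le_mul_of_nonneg_right (Matrix.l2_opNorm_mul _ _) (norm_nonneg _))
        _ ≤ 1 * (8 * d * ((L : ℝ) ^ k - 1) * (L * δ)) * 1 := by
            refine mul_le_mul (mul_le_mul hJ1 h2 (norm_nonneg _) zero_le_one) hJH1 (norm_nonneg _) ?_
            have : 0 ≤ 8 * d * ((L : ℝ) ^ k - 1) * (L * δ) := by
              have : (0 : ℝ) ≤ (L : ℝ) ^ k - 1 := by linarith
              positivity
            linarith
        _ = 8 * d * ((L : ℝ) ^ k - 1) * (L * δ) := by ring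
    have t3 : ‖J * (1 - K) * Jᴴ * (X * (1 - J * Jᴴ))‖ ≤ 2 * (d * L * δ) := by
      calc ‖J * (1 - K) * Jᴴ * (X * (1 - J * Jᴴ))‖ ≤ ‖J * (1 - K) * Jᴴ‖ * ‖X * (1 - J * Jᴴ)‖ := Matrix.l2_opNorm_mul _ _
        _ ≤ 1 * (2 * (d * L * δ)) := by
            refine mul_le_mul ?_ h3 (norm_nonneg _) zero_le_one
            calc ‖J * (1 - K) * Jᴴ‖ ≤ ‖J‖ * ‖1 - K‖ * ‖Jᴴ‖ :=
                  (Matrix.l2_opNorm_mul _ _).trans (mul_le_mul_of_nonneg_right (Matrix.l2_opNorm_mul _ _) (norm_nonneg _))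
              _ ≤ 1 * 1 * 1 := mul_le_mul (mul_le_mul hJ1 hK1 (norm_nonneg _) zero_le_one) hJH1 (norm_nonneg _) (by norm_num)
              _ = 1 := by ring
        _ = 2 * (d * L * δ) := one_mul _
    calc ‖(1 - J * Jᴴ) * X + J * ((1 - K) * Y) * Jᴴ + J * (1 - K) * Jᴴ * (X * (1 - J * Jᴴ))‖
        ≤ ‖(1 - J * Jᴴ) * X‖ + ‖J * ((1 - K) * Y) * Jᴴ‖ + ‖J * (1 - K) * Jᴴ * (X * (1 - J * Jᴴ))‖ := norm_add₃_le
      _ ≤ 2 * (d * L * δ) + 8 * d * ((L : ℝ) ^ k - 1) * (L * δ) + 2 * (d * L * δ) := add_le_add (add_le_add h1 t2) t3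
      _ = (8 * d * (L : ℝ) ^ (k + 1) - 4 * d * L) * δ := by ring
      _ ≤ 8 * d * ((L : ℝ) ^ (k + 1) - 1) * δ := by
          apply mul_le_mul_of_nonneg_right _ hδ
          nlinarith

end Poincare

end Summit.QuantumFields.BalabanUV.T4Continuum.ScalarMassTower

end
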